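import Literature.Barriers.FinalStateConjecture.NonSmoothNullInfinityUDecay
import HarnessLib

/-!
# Barrier catalogue `FinalStateConjecture`: the linear scattering problem on Schwarzschild —
# the decay estimate (6.17) at all orders (discharge of `SchwarzschildLinearScattering_uDecay`)
(`Literature/Barriers/FinalStateConjecture/`, D-0021, D-0014; namespace
`Literature.Barriers.FinalStateConjecture`, sub-namespace `ScatDecay` for the tower)

Kehrberger's Thm. 6.2, eq. (6.17) (arXiv:2105.08079v3): if the moments `I⁽ᵏ⁾[G]`, `k < n`, of the
compactly supported scattering data vanish, then `|ψ(u,v) + I⁽ⁿ⁾[G](n+1)!/|u|^{2+n}| ≤ C log|u|/|u|^{3+n}`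
on `{u < U₀, v ≥ v₂}` (EF gauge, footnote 55). The printed proof is an induction on `n` through the
time integral: `ψ = ∂ᵤψ^T + ∂ᵥψ^T` with `ψ^T` the scattering solution of `G^T = ∫_{v₁}^{v} G`
(`I⁽ⁿ⁻¹⁾[G^T] = I⁽ⁿ⁾[G]`), the hypothesis being used "commuted with `∂ᵤ^m`" for all `m`. This file runs
that tower for the constructed field:

* `ScatDecay.uDeriv_tower` — for every `n` and all `m`:
  `|∂ᵤ^m χ(u,v) + I⁽ⁿ⁾[G] (n+1+m)!/|u|^{2+n+m}| ≤ C_m log|u|/|u|^{3+n+m}` on `{u ≤ U₀, v ≥ v₂}`; base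
  `ScatDecay.uDeriv_base` (`NonSmoothNullInfinityUDecay.lean`), step: `∂ᵤ^m χ = ∂ᵤ^{m+1} χ^T − ∂ᵤ^m Ξ^T`
  with `Ξ^T = ∫_{−∞}^{u} Vχ^T` (`∂ᵥχ^T = −Ξ^T` beyond the data), `∂ᵤ^{k+1} Ξ^T = ∂ᵤ^k (Vχ^T)` bounded
  by the Leibniz rule and the induction hypothesis, `Ξ^T` itself by the `U`-rule;
* `SchwarzschildLinearScattering_uDecay_holds` — the named fact, for any `IsScatteringSolution` by
  uniqueness (`m = 0` of the tower).

## References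

* L. M. A. Kehrberger, *The case against smooth null infinity I*, Ann. Henri Poincaré 23 (2022)
  829–921 = arXiv:2105.08079 (v3, 2023), Thm. 6.2 eq. (6.17) and its proof (eqs. (6.22)–(6.25)),
  §6.2 footnote 55. Key `Kehrberger2022AHP`.
-/

noncomputable section

open Set Filter Topology MeasureTheory intervalIntegral Function Asymptotics Polynomial

namespace Literature.Barriers.FinalStateConjecture

namespace ScatDecay

/-! ### `u`-derivatives of the `u`-primitive and a Leibniz bound -/

section Tools

variable {M : ℝ} {r : ℝ → ℝ → ℝ} (hr : IsEFAreaRadius M r) (hM : 0 < M)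
include hr hM

/-- `∂ᵤ^{k+1} ∫_{−∞}^{u} h = ∂ᵤ^k h` for potential-dominated continuous integrands. [folklore] -/
theorem iteratedDeriv_succ_uPrimitive_left {h : ℝ → ℝ → ℝ} (hh : IsPotentialDominated M r h)
    (hc : Continuous (uncurry h)) (k : ℕ) (u v : ℝ) :
    iteratedDeriv (k + 1) (fun u' ↦ uPrimitive h u' v) u = iteratedDeriv k (fun u' ↦ h u' v) u := by
  rw [iteratedDeriv_succ']
  congr 1
  funext u'
  exact (hasDerivAt_uPrimitive_left hr hM hh hc u' v).deriv

/-- **Leibniz bound for `∂ᵤ^k (Vf)` at a point**: if `|∂ᵤ^j f(u, v)| ≤ D/|u|^{p+j}` for `j ≤ k`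
and `1/r(u,v) ≤ 2/|u|`, then `|∂ᵤ^k (V f)(u, v)| ≤ (Σ_i C(k,i) K_i 2^{3+i}) D/|u|^{3+p+k}`.
[folklore] -/
theorem abs_iteratedDeriv_potential_mul_le {f : ℝ → ℝ} {u v D : ℝ} {p k : ℕ}
    (hf : ContDiff ℝ ((⊤ : ℕ∞) : WithTop ℕ∞) f) (hu : 0 < -u) (hρ : (r u v)⁻¹ ≤ 2 / -u)
    {K : ℕ → ℝ} (hK0 : ∀ i, 0 ≤ K i)
    (hK : ∀ i, |iteratedDeriv i (fun u' ↦ radialPotential M (r u' v)) u| ≤ K i * (r u v ^ (3 + i))⁻¹)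
    (hD : ∀ j, j ≤ k → |iteratedDeriv j f u| ≤ D * ((-u) ^ (p + j))⁻¹) :
    |iteratedDeriv k (fun u' ↦ radialPotential M (r u' v) * f u') u| ≤
      (∑ i ∈ Finset.range (k + 1), (k.choose i : ℝ) * K i * 2 ^ (3 + i)) * D * ((-u) ^ (3 + p + k))⁻¹ := by
  have hle : ((k : ℕ) : WithTop ℕ∞) ≤ ((⊤ : ℕ∞) : WithTop ℕ∞) := by exact_mod_cast le_top
  have hD0 : 0 ≤ D := by
    have h := hD 0 (Nat.zero_le _)
    have hp : 0 < ((-u) ^ (p + 0))⁻¹ := by positivity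
    nlinarith [abs_nonneg (iteratedDeriv 0 f u)]
  have hr0 : 0 < r u v := hr.pos hM.le u v
  have hVc : ContDiffAt ℝ k (fun u' ↦ radialPotential M (r u' v)) u :=
    ((contDiff_potential_left hr hM v).of_le hle).contDiffAt
  have hfc : ContDiffAt ℝ k f u := (hf.of_le hle).contDiffAt
  rw [iteratedDeriv_fun_mul hVc hfc]
  have hterm : ∀ i ∈ Finset.range (k + 1), |(k.choose i : ℝ) * iteratedDeriv i (fun u' ↦ radialPotential M (r u' v)) u *
      iteratedDeriv (k - i) f u| ≤ (k.choose i : ℝ) * K i * 2 ^ (3 + i) * (D * ((-u) ^ (3 + p + k))⁻¹) := by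
    intro i hi
    have hik : i ≤ k := Nat.lt_succ_iff.mp (Finset.mem_range.mp hi)
    rw [abs_mul, abs_mul, Nat.abs_cast]
    have h1 := hK i
    have h2 := hD (k - i) (Nat.sub_le k i)
    have hρi : (r u v ^ (3 + i))⁻¹ ≤ (2 / -u) ^ (3 + i) := by
      rw [← inv_pow]; exact pow_le_pow_left₀ (by positivity) hρ _
    have hexp : (2 / -u) ^ (3 + i) * ((-u) ^ (p + (k - i)))⁻¹ = 2 ^ (3 + i) * ((-u) ^ (3 + p + k))⁻¹ := by
      rw [div_pow, div_eq_mul_inv, show ((-u) ^ (3 + p + k))⁻¹ = ((-u) ^ (3 + i))⁻¹ * ((-u) ^ (p + (k - i)))⁻¹ by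
        rw [← mul_inv, ← pow_add]; congr 2; omega]
      ring
    calc (k.choose i : ℝ) * |iteratedDeriv i (fun u' ↦ radialPotential M (r u' v)) u| * |iteratedDeriv (k - i) f u|
        ≤ (k.choose i : ℝ) * (K i * (2 / -u) ^ (3 + i)) * (D * ((-u) ^ (p + (k - i)))⁻¹) :=
          mul_le_mul (mul_le_mul_of_nonneg_left (h1.trans (mul_le_mul_of_nonneg_left hρi (hK0 i))) (Nat.cast_nonneg _))
            h2 (abs_nonneg _) (mul_nonneg (Nat.cast_nonneg _) (mul_nonneg (hK0 i) (by positivity)))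
      _ = (k.choose i : ℝ) * K i * D * ((2 / -u) ^ (3 + i) * ((-u) ^ (p + (k - i)))⁻¹) := by ring
      _ = (k.choose i : ℝ) * K i * 2 ^ (3 + i) * (D * ((-u) ^ (3 + p + k))⁻¹) := by rw [hexp]; ring
  refine (Finset.abs_sum_le_sum_abs _ _).trans ((Finset.sum_le_sum hterm).trans (le_of_eq ?_))
  rw [← Finset.sum_mul]
  ring

end Tools

/-! ### The tower -/

section Tower

variable {M : ℝ} {r : ℝ → ℝ → ℝ} {v₁ v₂ : ℝ} (hr : IsEFAreaRadius M r) (hM : 0 < M) (h12 : v₁ < v₂)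
include hr hM h12

/-- **Kehrberger's (6.17) for the constructed scattering field, commuted with all `∂ᵤ^m`**
(induction on the number `n` of vanishing moments through the time integral): there are `U₀ ≤ −3`
and, for every `m`, a constant `C` with
`|∂ᵤ^m χ(u, v) + I⁽ⁿ⁾[G] (n+1+m)!/|u|^{2+n+m}| ≤ C log|u|/|u|^{3+n+m}` for `u ≤ U₀`, `v ≥ v₂`.
[cite: Kehrberger2022AHP, Thm. 6.2 eq. (6.17) and its proof] -/
theorem uDeriv_tower : ∀ (n : ℕ) {G : ℝ → ℝ} {CG : ℝ}
    (hG : ContDiff ℝ ((⊤ : ℕ∞) : WithTop ℕ∞) G) (hsupp : tsupport G ⊆ Ioo v₁ v₂) (hGb : ∀ v, |G v| ≤ CG),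
    (∀ k < n, kehrbergerMoment M G k = 0) →
    ∃ U₀ : ℝ, U₀ ≤ -3 ∧ ∀ m : ℕ, ∃ C : ℝ, 0 ≤ C ∧ ∀ u, u ≤ U₀ → ∀ v, v₂ ≤ v →
      |iteratedDeriv m (fun u' ↦ scatteringField hr hM hG.continuous hGb (data_eq_zero hsupp) u' v) u +
        kehrbergerMoment M G n * ((n + 1 + m).factorial : ℝ) * ((-u) ^ (2 + n + m))⁻¹| ≤
        C * Real.log (-u) * ((-u) ^ (3 + n + m))⁻¹ := by
  intro n
  induction n with
  | zero =>
    intro G CG hG hsupp hGb _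
    obtain ⟨U₀, A, _, hR⟩ := exists_goodRegion hr hM v₁ v₂
    refine ⟨U₀, hR.U₀_le, fun m ↦ ?_⟩
    obtain ⟨C, hC0, -, hlead⟩ := uDeriv_base hr hM hG hsupp hGb hR h12.le m
    refine ⟨C, hC0, fun u hu v hv ↦ ?_⟩
    have hmom : kehrbergerMoment M G 0 = M * ∫ v' in v₁..v₂, G v' := by
      rw [kehrbergerMoment_zero, ← scatteringTimeIntegral_eq_integral_of_le hsupp le_rfl, scatteringTimeIntegral_apply]
    have h := hlead m le_rfl u hu v hv
    rw [hmom, show 0 + 1 + m = m + 1 by ring, show 2 + 0 + m = 2 + m by ring, show 3 + 0 + m = 3 + m by ring]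
    exact h
  | succ n ih =>
    intro G CG hG hsupp hGb hmom
    -- the time-integrated data and the induction hypothesis for its field
    have h0 : ∫ v, G v = 0 := by
      have := hmom 0 (Nat.succ_pos n)
      rw [kehrbergerMoment_zero] at this
      exact (mul_eq_zero.1 this).resolve_left hM.ne'
    set GT := scatteringTimeIntegral v₁ G with hGT
    have hGTd : ContDiff ℝ ((⊤ : ℕ∞) : WithTop ℕ∞) GT := scatteringTimeIntegral_contDiff hG v₁
    have hGTsupp : tsupport GT ⊆ Ioo v₁ v₂ := tsupport_scatteringTimeIntegral_subset hsupp h0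
    obtain ⟨CGT, hGTb⟩ := exists_bound_of_tsupport hGTd.continuous hGTsupp
    have hmomT : ∀ k < n, kehrbergerMoment M GT k = 0 := fun k hk ↦ by
      rw [hGT, kehrbergerMoment_scatteringTimeIntegral hG.continuous hsupp h0 M k]
      exact hmom (k + 1) (by omega)
    have hmomTn : kehrbergerMoment M GT n = kehrbergerMoment M G (n + 1) :=
      kehrbergerMoment_scatteringTimeIntegral hG.continuous hsupp h0 M n
    obtain ⟨U₀T, hU₀T, hIH⟩ := ih hGTd hGTsupp hGTb hmomT
    obtain ⟨U₀', A', _, hR'⟩ := exists_goodRegion hr hM v₁ v₂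
    set χ := scatteringField hr hM hG.continuous hGb (data_eq_zero hsupp) with hχ
    set χT := scatteringField hr hM hGTd.continuous hGTb (data_eq_zero hGTsupp) with hχT
    have hbT : ScatBootstrap M r v₁ GT χT := scatBootstrap_scatteringField hr hM hGTd hGTsupp hGTb
    have hsol := isScatteringSolution_scatteringField hr hM hG hsupp hGb
    have hsolT := isScatteringSolution_scatteringField hr hM hGTd hGTsupp hGTb
    have hTid : ∀ u v, χ u v = partialU χT u v + partialV χT u v :=
      SchwarzschildLinearScattering_timeIntegral_holds M hM r hr G v₁ v₂ h12 hG hsupp h0 χ χT hsol hsolT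
    have hsT : ContDiff ℝ ((⊤ : ℕ∞) : WithTop ℕ∞) (Function.uncurry χT) := hsolT.1.1
    -- the integrand `VχT` of `Ξ^T`
    set g : ℝ → ℝ → ℝ := fun u v ↦ radialPotential M (r u v) * χT u v with hg
    have hgc : Continuous (uncurry g) := continuous_potential_mul_scatteringField hr hM hGTd.continuous hGTb (data_eq_zero hGTsupp)
    have hgd : IsPotentialDominated M r g := isPotentialDominated_potential_mul_scatteringField hr hM hGTd.continuous hGTb (data_eq_zero hGTsupp)
    -- constants from the induction hypothesis: `|∂ᵤ^j χT| ≤ D_j/|u|^{2+n+j}`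
    choose CT hCT0 hCT using hIH
    choose K hK0 hK using fun i ↦ abs_iteratedDeriv_potential_left_le hr hM i
    refine ⟨min U₀T U₀', (min_le_left _ _).trans hU₀T, fun m ↦ ?_⟩
    -- a uniform constant for `|∂ᵤ^j χT|`, `j ≤ m`
    set D : ℝ := ∑ j ∈ Finset.range (m + 1), (|kehrbergerMoment M GT n| * ((n + 1 + j).factorial : ℝ) + CT j) with hD
    have hD0 : 0 ≤ D := Finset.sum_nonneg fun j _ ↦ by have := hCT0 j; positivity
    have hDj : ∀ j, j ≤ m → ∀ u, u ≤ min U₀T U₀' → ∀ v, v₂ ≤ v →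
        |iteratedDeriv j (fun u' ↦ χT u' v) u| ≤ D * ((-u) ^ (2 + n + j))⁻¹ := by
      intro j hj u hu v hv
      have huT : u ≤ U₀T := hu.trans (min_le_left _ _)
      have hu0 : 0 < -u := by linarith
      have hu1 : 1 ≤ -u := by linarith
      have h := hCT j u huT v hv
      have hlogu : Real.log (-u) ≤ -u := (Real.log_le_sub_one_of_pos hu0).trans (by linarith)
      -- `|x| ≤ |x + y| + |y|`
      have h1 : |iteratedDeriv j (fun u' ↦ χT u' v) u| ≤ CT j * Real.log (-u) * ((-u) ^ (3 + n + j))⁻¹ +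
          |kehrbergerMoment M GT n| * ((n + 1 + j).factorial : ℝ) * ((-u) ^ (2 + n + j))⁻¹ := by
        have := abs_sub_abs_le_abs_sub (iteratedDeriv j (fun u' ↦ χT u' v) u)
          (-(kehrbergerMoment M GT n * ((n + 1 + j).factorial : ℝ) * ((-u) ^ (2 + n + j))⁻¹))
        rw [sub_neg_eq_add, abs_neg, abs_mul, abs_mul, abs_of_nonneg (by positivity : (0:ℝ) ≤ ((n + 1 + j).factorial : ℝ)),
          abs_of_pos (by positivity : (0:ℝ) < ((-u) ^ (2 + n + j))⁻¹)] at this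
        linarith
      have h2 : CT j * Real.log (-u) * ((-u) ^ (3 + n + j))⁻¹ ≤ CT j * ((-u) ^ (2 + n + j))⁻¹ := by
        have : Real.log (-u) * ((-u) ^ (3 + n + j))⁻¹ ≤ ((-u) ^ (2 + n + j))⁻¹ := by
          rw [show 3 + n + j = (2 + n + j) + 1 by ring, pow_succ, mul_inv]
          calc Real.log (-u) * (((-u) ^ (2 + n + j))⁻¹ * (-u)⁻¹) = (Real.log (-u) * (-u)⁻¹) * ((-u) ^ (2 + n + j))⁻¹ := by ring
            _ ≤ 1 * ((-u) ^ (2 + n + j))⁻¹ := by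
                refine mul_le_mul_of_nonneg_right ?_ (by positivity)
                rw [mul_inv_le_iff₀ hu0]; linarith
            _ = ((-u) ^ (2 + n + j))⁻¹ := one_mul _
        calc CT j * Real.log (-u) * ((-u) ^ (3 + n + j))⁻¹ = CT j * (Real.log (-u) * ((-u) ^ (3 + n + j))⁻¹) := by ring
          _ ≤ CT j * ((-u) ^ (2 + n + j))⁻¹ := mul_le_mul_of_nonneg_left this (hCT0 j)
      have h3 : |kehrbergerMoment M GT n| * ((n + 1 + j).factorial : ℝ) + CT j ≤ D := by
        rw [hD]
        exact Finset.single_le_sum (f := fun j ↦ |kehrbergerMoment M GT n| * ((n + 1 + j).factorial : ℝ) + CT j)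
          (fun i _ ↦ by have := hCT0 i; positivity) (Finset.mem_range.2 (by omega))
      have hpos : 0 ≤ ((-u) ^ (2 + n + j))⁻¹ := by positivity
      nlinarith [h1, h2, h3, hpos]
    -- the constant
    set L : ℝ := ∑ i ∈ Finset.range m, ((m - 1).choose i : ℝ) * K i * 2 ^ (3 + i) with hL
    have hL0 : 0 ≤ L := Finset.sum_nonneg fun i _ ↦ by have := hK0 i; positivity
    set Cnew : ℝ := CT (m + 1) + L * D + 16 * M * D with hCnew
    have hCnew0 : 0 ≤ Cnew := by have := hCT0 (m + 1); positivity
    refine ⟨Cnew, hCnew0, fun u hu v hv ↦ ?_⟩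
    have huT : u ≤ U₀T := hu.trans (min_le_left _ _)
    have hu' : u ≤ U₀' := hu.trans (min_le_right _ _)
    have hu0 : 0 < -u := by linarith
    have hu1 : 1 ≤ -u := by linarith
    have hlog1 : 1 ≤ Real.log (-u) := by
      rw [← Real.log_exp 1]
      exact Real.log_le_log (Real.exp_pos 1) (by have := Real.exp_one_lt_three; linarith)
    have hv1 : v₁ ≤ v := h12.le.trans hv
    have hρ : (r u v)⁻¹ ≤ 2 / -u := hR'.inv_radius_le hr hM hu' hv1
    -- `∂ᵤ^m χ = ∂ᵤ^{m+1} χT + ∂ᵤ^m (∂ᵥ χT)` and `∂ᵥχT(·, v) = −Ξ^T(·, v)` for `v ≥ v₂`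
    have hpU : ContDiff ℝ ((⊤ : ℕ∞) : WithTop ℕ∞) (fun u' ↦ partialU χT u' v) :=
      (contDiff_partialU hsT).comp (contDiff_prodMk_left v)
    have hpV : ContDiff ℝ ((⊤ : ℕ∞) : WithTop ℕ∞) (fun u' ↦ partialV χT u' v) :=
      (contDiff_partialV hsT).comp (contDiff_prodMk_left v)
    have hle : ((m : ℕ) : WithTop ℕ∞) ≤ ((⊤ : ℕ∞) : WithTop ℕ∞) := by exact_mod_cast le_top
    have hVeq : (fun u' ↦ partialV χT u' v) = fun u' ↦ -uPrimitive g u' v := by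
      funext u'
      have hd := (hbT.deriv_right u' v).deriv
      have hGv : deriv GT v = 0 := by
        rw [hGT, deriv_scatteringTimeIntegral hG.continuous]
        exact eq_zero_of_tsupport_subset_Ioo hsupp (Or.inr hv)
      simp only [partialV, hd, hGv, zero_sub, hg]
    have esplit : iteratedDeriv m (fun u' ↦ χ u' v) u =
        iteratedDeriv (m + 1) (fun u' ↦ χT u' v) u - iteratedDeriv m (fun u' ↦ uPrimitive g u' v) u := by
      have hfun : (fun u' ↦ χ u' v) = fun u' ↦ partialU χT u' v + partialV χT u' v := funext fun u' ↦ hTid u' v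
      rw [hfun, iteratedDeriv_fun_add (hpU.of_le hle).contDiffAt (hpV.of_le hle).contDiffAt, hVeq,
        iteratedDeriv_fun_neg, iteratedDeriv_succ', sub_eq_add_neg]
      rfl
    -- the first term: induction hypothesis at order `m + 1`
    have hfirst := hCT (m + 1) u huT v hv
    rw [hmomTn] at hfirst
    -- the second term: `∂ᵤ^m Ξ^T`
    have hsecond : |iteratedDeriv m (fun u' ↦ uPrimitive g u' v) u| ≤ (L * D + 16 * M * D) * ((-u) ^ (4 + n + m))⁻¹ := by
      cases m with
      | zero =>
        -- `Ξ^T` itself by the `U`-rule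
        rw [iteratedDeriv_zero]
        have hB : ∀ u', u' ≤ u → |g u' v| ≤ 2 * M * D * (((-u') ^ (n + 2))⁻¹ * (r u' v ^ 3)⁻¹) := by
          intro u' hu'
          have hu'0 : 0 < -u' := by linarith
          have hp : 0 ≤ radialPotential M (r u' v) := (radialPotential_pos hM (hr.1 u' v)).le
          have hr0 : 0 < r u' v := hr.pos hM.le u' v
          have hV : radialPotential M (r u' v) ≤ 2 * M / r u' v ^ 3 := radialPotential_le hM.le hr0
          have hχ' := hDj 0 (le_refl 0) u' (hu'.trans hu) v hv
          rw [iteratedDeriv_zero] at hχ'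
          simp only [hg]
          rw [abs_mul, abs_of_nonneg hp]
          calc radialPotential M (r u' v) * |χT u' v| ≤ (2 * M / r u' v ^ 3) * (D * ((-u') ^ (2 + n + 0))⁻¹) :=
                mul_le_mul hV hχ' (abs_nonneg _) (by positivity)
            _ = 2 * M * D * (((-u') ^ (n + 2))⁻¹ * (r u' v ^ 3)⁻¹) := by
                rw [show 2 + n + 0 = n + 2 by ring, div_eq_mul_inv]; ring
        have hU := abs_uPrimitive_le_U hr hM hR' (C := 2 * M * D) (a := n) (b := 3) hu' (v := v) (h := g) hB
        refine hU.trans ?_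
        have hr0 : 0 < r u v := hr.pos hM.le u v
        have h3 : (r u v ^ 3)⁻¹ ≤ (2 / -u) ^ 3 := by rw [← inv_pow]; exact pow_le_pow_left₀ (by positivity) hρ 3
        have hn1 : (((n : ℝ) + 1) * (-u) ^ (n + 1))⁻¹ ≤ ((-u) ^ (n + 1))⁻¹ := by
          rw [mul_inv]
          refine mul_le_of_le_one_left (by positivity) ?_
          rw [inv_le_one_iff₀]; right; have : (0:ℝ) ≤ n := Nat.cast_nonneg n; linarith
        calc 2 * M * D * ((((n : ℝ) + 1) * (-u) ^ (n + 1))⁻¹ * (r u v ^ 3)⁻¹)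
            ≤ 2 * M * D * (((-u) ^ (n + 1))⁻¹ * (2 / -u) ^ 3) :=
              mul_le_mul_of_nonneg_left (mul_le_mul hn1 h3 (by positivity) (by positivity)) (by positivity)
          _ = 16 * M * D * ((-u) ^ (4 + n + 0))⁻¹ := by
              rw [show 4 + n + 0 = (n + 1) + 3 by ring, pow_add, mul_inv, div_pow]; ring
          _ ≤ (L * D + 16 * M * D) * ((-u) ^ (4 + n + 0))⁻¹ := by
              have : 0 ≤ L * D * ((-u) ^ (4 + n + 0))⁻¹ := by positivity
              nlinarith
      | succ k =>
        -- `∂ᵤ^{k+1} Ξ^T = ∂ᵤ^k (VχT)`, Leibniz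
        rw [iteratedDeriv_succ_uPrimitive_left hr hM hgd hgc k u v]
        have hfT : ContDiff ℝ ((⊤ : ℕ∞) : WithTop ℕ∞) (fun u' ↦ χT u' v) := contDiff_field_left hr hM hbT v
        have hDk : ∀ j, j ≤ k → |iteratedDeriv j (fun u' ↦ χT u' v) u| ≤ D * ((-u) ^ ((2 + n) + j))⁻¹ :=
          fun j hj ↦ hDj j (by omega) u hu v hv
        have h := abs_iteratedDeriv_potential_mul_le hr hM (f := fun u' ↦ χT u' v) (p := 2 + n) (k := k)
          hfT hu0 hρ hK0 (fun i ↦ hK i u v) hDk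
        have hL' : (∑ i ∈ Finset.range (k + 1), (k.choose i : ℝ) * K i * 2 ^ (3 + i)) = L := by
          simp only [hL, Nat.add_sub_cancel]
        rw [hL', show 3 + (2 + n) + k = 4 + n + (k + 1) by ring] at h
        have hgoal : |iteratedDeriv k (fun u' ↦ g u' v) u| ≤ L * D * ((-u) ^ (4 + n + (k + 1)))⁻¹ := h
        refine hgoal.trans ?_
        have : 0 ≤ 16 * M * D * ((-u) ^ (4 + n + (k + 1)))⁻¹ := by positivity
        nlinarith
    -- assemble
    rw [esplit]
    have hkey : iteratedDeriv (m + 1) (fun u' ↦ χT u' v) u - iteratedDeriv m (fun u' ↦ uPrimitive g u' v) u +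
        kehrbergerMoment M G (n + 1) * ((n + 1 + 1 + m).factorial : ℝ) * ((-u) ^ (2 + (n + 1) + m))⁻¹ =
        (iteratedDeriv (m + 1) (fun u' ↦ χT u' v) u +
          kehrbergerMoment M G (n + 1) * ((n + 1 + (m + 1)).factorial : ℝ) * ((-u) ^ (2 + n + (m + 1)))⁻¹) -
        iteratedDeriv m (fun u' ↦ uPrimitive g u' v) u := by
      rw [show n + 1 + 1 + m = n + 1 + (m + 1) by ring, show 2 + (n + 1) + m = 2 + n + (m + 1) by ring]
      ring
    rw [hkey]
    refine (abs_sub _ _).trans ?_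
    have hpow : ((-u) ^ (4 + n + m))⁻¹ ≤ Real.log (-u) * ((-u) ^ (3 + (n + 1) + m))⁻¹ := by
      rw [show 3 + (n + 1) + m = 4 + n + m by ring]
      have : 0 ≤ ((-u) ^ (4 + n + m))⁻¹ := by positivity
      nlinarith
    rw [show 3 + n + (m + 1) = 3 + (n + 1) + m by ring] at hfirst
    calc |iteratedDeriv (m + 1) (fun u' ↦ χT u' v) u +
          kehrbergerMoment M G (n + 1) * ((n + 1 + (m + 1)).factorial : ℝ) * ((-u) ^ (2 + n + (m + 1)))⁻¹| +
          |iteratedDeriv m (fun u' ↦ uPrimitive g u' v) u|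
        ≤ CT (m + 1) * Real.log (-u) * ((-u) ^ (3 + (n + 1) + m))⁻¹ + (L * D + 16 * M * D) * ((-u) ^ (4 + n + m))⁻¹ :=
          add_le_add hfirst hsecond
      _ ≤ CT (m + 1) * Real.log (-u) * ((-u) ^ (3 + (n + 1) + m))⁻¹ +
          (L * D + 16 * M * D) * (Real.log (-u) * ((-u) ^ (3 + (n + 1) + m))⁻¹) := by
          have : 0 ≤ L * D + 16 * M * D := by positivity
          exact add_le_add le_rfl (mul_le_mul_of_nonneg_left hpow this)
      _ = Cnew * Real.log (-u) * ((-u) ^ (3 + (n + 1) + m))⁻¹ := by simp only [hCnew]; ring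

end Tower

end ScatDecay

/-! ### Discharge of the named fact -/

/-- **Discharge of `SchwarzschildLinearScattering_uDecay`** (Kehrberger, Thm. 6.2 eq. (6.17), EF gauge
with the `log|u|` of footnote 55): for every scattering solution with smooth data supported in
`(v₁, v₂)` and vanishing moments `I⁽ᵏ⁾[G]`, `k < n`:
`|ψ(u,v) + I⁽ⁿ⁾[G](n+1)!/|u|^{2+n}| ≤ C log|u|/|u|^{3+n}` for `u < U₀`, `v ≥ v₂` (the constructed field
by uniqueness, `m = 0` of the tower `ScatDecay.uDeriv_tower`).
[cite: Kehrberger2022AHP, Thm. 6.2 eq. (6.17), §6.2 footnote 55] -/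
theorem SchwarzschildLinearScattering_uDecay_holds : SchwarzschildLinearScattering_uDecay := by
  intro M hM r hr G v₁ v₂ h12 hG hsupp n hmom ψ hψ
  obtain ⟨CG, hGb⟩ := exists_bound_of_tsupport hG.continuous hsupp
  have hsol := isScatteringSolution_scatteringField hr hM hG hsupp hGb
  have e := SchwarzschildLinearScattering_unique_holds M hM r hr G v₁ _ _ hψ hsol
  subst e
  obtain ⟨U₀, hU₀, htower⟩ := ScatDecay.uDeriv_tower hr hM h12 n hG hsupp hGb hmom
  obtain ⟨C, -, hC⟩ := htower 0
  refine ⟨U₀, by linarith, C, fun u hu v hv ↦ ?_⟩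
  have h := hC u hu.le v hv
  have hu0 : 0 < -u := by linarith
  have habs : |u| = -u := abs_of_neg (by linarith)
  rw [iteratedDeriv_zero, show n + 1 + 0 = n + 1 by ring, show 2 + n + 0 = 2 + n by ring,
    show 3 + n + 0 = 3 + n by ring] at h
  rw [habs, div_eq_mul_inv, div_eq_mul_inv]
  exact h

end Literature.Barriers.FinalStateConjecture

end
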